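import Mathlib.Analysis.Calculus.LocalExtr.Rolle
import Mathlib.Analysis.Complex.RealDeriv
import Mathlib.Order.LiminfLimsup
import Literature.NumberTheory.LFunctions.XiDerivativeZerosProofs
import Literature.NumberTheory.LFunctions.XiDerivPositiveAxis
import HarnessLib

/-!
# RH-FREE — «nothing here bears on the truth of RH»: the zeros of `ξ′` — Conrey 1983 Lemma 2 for `m = 1` (open strip), finiteness, monotonicity and unboundedness of the counts `N_{ξ′}(T)`, `N_{0,ξ′}(T)`, and the `liminf`/dyadic bookkeeping for `κ′₁`

Topic `Literature/NumberTheory/LFunctions` (namespace `Literature.NumberTheory.LFunctions`; helper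
lemmas in the sub-namespace `XiDerivCount`). PROOF LAYER (everything below is a theorem; no
definition, no named fact) for the statement file `XiDerivativeZeros.lean` — J. B. Conrey, *Zeros
of derivatives of Riemann's ξ-function on the critical line*, J. Number Theory **16** (1983) 49–74
[`Conrey1983`]: the counting functions `N^{(1)}(T) = xiDerivZeroCount 1 T` (zeros of
`ξ′ = iteratedDeriv 1 riemannXi` with `0 < Im s ≤ T`, with multiplicity `analyticOrderAt`),
`N^{(1)}₀(T) = xiDerivCriticalZeroCount 1 T` (those on `Re s = ½`), the proportion
`κ′₁ = xiDerivCriticalLineProportion 1 = liminf N^{(1)}₀/N^{(1)}`, and the named fact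
`conrey1983_xiDeriv_one : 0.8137 ≤ κ′₁` (Corollary, p. 50). The cell `rh-columns/lit` uses this
file to tie Alpöge–Furman 2026 Remark 7.1 to `conrey1983_xiDeriv_one`
(`CriticalLineTwoThirdsXiDeriv.lean`); the statements below are source-independent.

## What is proved (all RH-free unless marked; axioms standard)

1. **Conrey 1983, Lemma 2, first sentence, for `m = 1`** (p. 52: "Any zero of `ξ^{(m)}(s)`
   satisfies `0 < σ < 1`"; p. 49: "It follows from Lemma 2 that the zeros of `ξ^{(m)}(s)` lie in the
   strip `0 < σ < 1`"): `Conrey1983_lemma2_xiDeriv_strip` — every zero of `ξ′` lies in the OPEN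
   critical strip. Printed proof: Hadamard factorisation and `Re(ξ′/ξ) ≠ 0` off the strip; here
   `Re ξ′/ξ(s) = Σ_ρ m(ρ) Re 1/(s − ρ) > 0` for `Re s ≥ 1` is the tree's
   `Lagarias1999Eq14.re_logDeriv_riemannXi_pos_of_one_le_re` (Hadamard partial fraction with
   multiplicities, `hasSum_zeroOrder_mul_re_inv_sub`), and `ξ′(1 − s) = −ξ′(s)`
   (`deriv_riemannXi_one_sub`) reflects to `Re s ≤ 0`. (This is verbatim the body
   `∀ s, ξ′(s) = 0 → 0 < Re s < 1` of the stub `Sig.stub_zerosInStrip` of the crux `XiPrimeOnLine`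
   of route `LaguerreSpeiserSplit`, which can now be closed by import.)
2. **The real zeros of `ξ′`**: `ξ′(½) = 0` and `ξ′(σ) ≠ 0` for real `σ ≠ ½`
   (`XiDerivCount.deriv_riemannXi_ofReal_eq_zero_iff`), from `ξ(s) = ξ₁((s − ½)²)`
   (`riemannXi_eq_xiSq`, chain rule `XiDerivCount.deriv_riemannXi_eq_xiSq`) and `ξ₁′ > 0` on
   `[0, ∞)` (`iteratedDeriv_xiSq_ofReal_ne_zero_of_nonneg`); on the critical line `ξ` is real and
   `ξ′` purely imaginary (`XiDerivCount.im_riemannXi_critical`, `XiDerivCount.re_deriv_riemannXi_critical`).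
3. **Finiteness**: `xiDerivZeroBox_one_finite` — the zeros of `ξ′` with `0 < Im s ≤ T` form a finite
   set (they lie in the compact rectangle `[0,1] × [0,T]` by 1., and the zero set of the entire, not
   identically vanishing `ξ′` is closed and discrete — Mathlib's
   `AnalyticOnNhd.preimage_zero_mem_codiscrete`, the route of `IsCompact.inter_riemannZetaZeros_finite`);
   so the `finsum`s defining `N^{(1)}`, `N^{(1)}₀` are genuine finite sums of multiplicities `≥ 1`
   (`XiDerivCount.one_le_analyticOrderAt_toNat`), non-decreasing in `T` (`xiDerivZeroCount_one_mono`,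
   `xiDerivCriticalZeroCount_one_mono`), with `N^{(1)}₀ ≤ N^{(1)}` (`xiDerivCriticalZeroCount_one_le`)
   and the window inequality `#S + N^{(1)}₀(T) ≤ N^{(1)}₀(T′)` for any set `S` of critical zeros with
   `T < Im s ≤ T′`, each listed once (`XiDerivCount.ncard_add_xiDerivCriticalZeroCount_le`).
4. **Unboundedness**: between two zeros `½ + ia`, `½ + ib` of `ξ` there is a zero of `ξ′` on the
   line (Rolle for the real function `t ↦ ξ(½ + it)`,
   `XiDerivCount.exists_deriv_riemannXi_eq_zero_between`); with Hardy's theorem (tree: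
   `hardy_infinite_zeros_on_critical_line_holds`) `ξ′` has zeros `½ + it` with `t` beyond any bound
   (`XiDerivCount.exists_deriv_riemannXi_eq_zero_gt`), hence `N^{(1)}₀(T) → ∞` and `N^{(1)}(T) → ∞`
   (`tendsto_xiDerivCriticalZeroCount_one_atTop`, `tendsto_xiDerivZeroCount_one_atTop`) — the
   qualitative shadow of Conrey's Lemma 2, second sentence
   (`N^{(m)}(T) = (T/2π) log(T/2π) − T/2π + O_m(log T)`), which is NOT proved here.
5. **`liminf` and dyadic bookkeeping** (the `ξ′`-copies of `le_criticalLineProportion_of_eventually_le`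
   of `ZeroCountingLevinsonProofs.lean` and of the telescoping `AlpogeFurman2026.Dyadic.telescope` of
   `CriticalLineTwoThirdsProofs.lean`, the latter written for a general non-decreasing unbounded
   count): `le_xiDerivCriticalLineProportion_one_of_eventually_le` (`c N^{(1)} ≤ N^{(1)}₀` eventually
   ⟹ `c ≤ κ′₁`), `XiDerivCount.telescope`, `XiDerivCount.eventually_of_telescope`,
   `le_xiDerivCriticalLineProportion_one_of_dyadic` (a dyadic simple-critical proportion `c`, in the
   shape of `AlpogeFurman2026_xiDeriv_simple_critical_dyadic`, gives `c ≤ κ′₁`) and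
   `XiDerivCount.eventually_cumulative_of_dyadic` (… gives the cumulative simple-critical proportion).
6. RH-CONDITIONAL tail (RH as explicit hypothesis; nothing asserted): under RH every zero of `ξ′` is
   on the line (Conrey p. 49; tree `riemannHypothesis_imp_xiDeriv_zeros_on_line_holds`), so
   `N^{(1)}₀ = N^{(1)}`, `κ′₁ = 1`, and RH ⟹ `conrey1983_xiDeriv_one`
   (`xiDerivCriticalZeroCount_one_eq_of_RH`, `xiDerivCriticalLineProportion_one_eq_one_of_RH`,
   `conrey1983_xiDeriv_one_of_RH`).

What is NOT here: Conrey's Lemma 2 for `m ≥ 2` and its asymptotic second sentence; any proportion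
theorem (`conrey1983_xiDeriv_one` stays a named fact). Nothing here bears on the truth of RH.

## References

* J. B. Conrey, J. Number Theory 16 (1983) 49–74: §1 (p. 49), Corollary (p. 50), Lemma 2 (p. 52)
  (held: `doi:10.1016/0022-314x(83)90031-8`). [`Conrey1983`]
* G. H. Hardy, *Sur les zéros de la fonction `ζ(s)` de Riemann*, C. R. Acad. Sci. Paris 158 (1914)
  1012–1014. [`Hardy1914`]
* L. Alpöge, R. Furman, arXiv:2608.13637v2 (2026), §6 (p. 12: "summing over dyadic windows") and
  Remark 7.1 (p. 14) — for the shape of the dyadic bookkeeping only. [`AlpogeFurman2026`]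
-/


noncomputable section

open Complex Filter Set Topology
open scoped ComplexConjugate

namespace Literature.NumberTheory.LFunctions

namespace XiDerivCount

/-! ## `ξ′` is entire and not identically zero -/

/-- `ξ′` is analytic on a neighbourhood of every point (derivative of the entire `ξ`). [cite: Conrey1983, Lemma 2 proof (p. 52): "ξ^{(m)}(s) which is entire"] -/
theorem analyticOnNhd_deriv_riemannXi : AnalyticOnNhd ℂ (deriv riemannXi) univ := by
  have h : AnalyticOnNhd ℂ riemannXi univ := fun z _ ↦ differentiable_riemannXi.analyticAt z
  exact h.deriv

end XiDerivCount

/-! ## Conrey 1983, Lemma 2 (`m = 1`): the zeros of `ξ′` lie in the open critical strip -/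

/-- `ξ′(s) ≠ 0` for `Re s ≥ 1`: there `ξ(s) ≠ 0` and `Re ξ′/ξ(s) = Σ_ρ m(ρ)(σ − β)/|s − ρ|² > 0`
(every `β < 1 ≤ σ`; tree `Lagarias1999Eq14.re_logDeriv_riemannXi_pos_of_one_le_re`), whereas
Mathlib's `logDeriv ξ s = ξ′(s)/ξ(s)` would vanish. [cite: Conrey1983, Lemma 2 (p. 52)] -/
theorem deriv_riemannXi_ne_zero_of_one_le_re {s : ℂ} (hs : 1 ≤ s.re) : deriv riemannXi s ≠ 0 := by
  intro h0
  have hpos := Lagarias1999Eq14.re_logDeriv_riemannXi_pos_of_one_le_re hs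
  rw [logDeriv_apply, h0, zero_div, Complex.zero_re] at hpos
  exact lt_irrefl _ hpos

/-- `ξ′(s) ≠ 0` for `Re s ≤ 0`, by the functional equation `ξ′(1 − s) = −ξ′(s)`
(`deriv_riemannXi_one_sub`). [cite: Conrey1983, Lemma 2 (p. 52)] -/
theorem deriv_riemannXi_ne_zero_of_re_nonpos {s : ℂ} (hs : s.re ≤ 0) : deriv riemannXi s ≠ 0 := by
  have h1 : 1 ≤ (1 - s).re := by
    simp only [Complex.sub_re, Complex.one_re]
    linarith
  have h := deriv_riemannXi_ne_zero_of_one_le_re h1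
  rw [deriv_riemannXi_one_sub] at h
  exact fun h0 ↦ h (by rw [h0, neg_zero])

/-- **Conrey 1983, Lemma 2, first sentence, `m = 1`** ("Any zero of `ξ^{(m)}(s)` satisfies
`0 < σ < 1`", p. 52; also p. 49: "It follows from Lemma 2 that the zeros of `ξ^{(m)}(s)` lie in the
strip `0 < σ < 1`"): every zero of `ξ′` lies in the open critical strip. PROVED (Hadamard partial
fraction with multiplicities + functional equation, as in print). This is verbatim the body of the
stub `Sig.stub_zerosInStrip` of the crux `XiPrimeOnLine` (route `LaguerreSpeiserSplit`).
[cite: Conrey1983, Lemma 2 (p. 52)] -/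
theorem Conrey1983_lemma2_xiDeriv_strip :
    ∀ s : ℂ, deriv riemannXi s = 0 → 0 < s.re ∧ s.re < 1 := fun _ h ↦
  ⟨lt_of_not_ge fun hle ↦ deriv_riemannXi_ne_zero_of_re_nonpos hle h,
    lt_of_not_ge fun hle ↦ deriv_riemannXi_ne_zero_of_one_le_re hle h⟩

/-- The box `xiDerivZeroBox 1 T` (zeros of `ξ′ = iteratedDeriv 1 ξ` with `0 < Im s ≤ T`) lies in the
open critical strip. [cite: Conrey1983, Lemma 2 (p. 52)] -/
theorem xiDerivZeroBox_one_subset_strip (T : ℝ) :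
    xiDerivZeroBox 1 T ⊆ {s : ℂ | 0 < s.re ∧ s.re < 1} := fun s hs ↦ by
  have h0 : deriv riemannXi s = 0 := by simpa only [iteratedDeriv_one] using hs.1
  exact Conrey1983_lemma2_xiDeriv_strip s h0

namespace XiDerivCount

/-! ## The real zeros of `ξ′` and the critical line -/

/-- Chain rule for `ξ(s) = ξ₁((s − ½)²)` (`riemannXi_eq_xiSq`):
`ξ′(s) = ξ₁′((s − ½)²) · 2(s − ½)`. [cite: Conrey1983, §1 (p. 49)] -/
theorem hasDerivAt_riemannXi_xiSq (s : ℂ) :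
    HasDerivAt riemannXi (deriv xiSq ((s - 1 / 2) ^ 2) * (2 * (s - 1 / 2))) s := by
  have h1 : HasDerivAt ((fun z : ℂ ↦ z - 1 / 2) ^ 2) (2 * (s - 1 / 2)) s := by
    simpa using ((hasDerivAt_id s).sub_const (1 / 2 : ℂ)).pow 2
  have h2 : HasDerivAt xiSq (deriv xiSq ((s - 1 / 2) ^ 2)) (((fun z : ℂ ↦ z - 1 / 2) ^ 2) s) :=
    (differentiable_xiSq _).hasDerivAt
  have h := h2.comp s h1
  have hfun : (xiSq ∘ ((fun z : ℂ ↦ z - 1 / 2) ^ 2)) = riemannXi := by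
    funext z
    simp only [Function.comp_apply, Pi.pow_apply, riemannXi_eq_xiSq]
  rwa [hfun] at h

/-- `ξ′(s) = 2(s − ½) ξ₁′((s − ½)²)`. [cite: Conrey1983, §1 (p. 49)] -/
theorem deriv_riemannXi_eq_xiSq (s : ℂ) :
    deriv riemannXi s = 2 * (s - 1 / 2) * deriv xiSq ((s - 1 / 2) ^ 2) := by
  rw [(hasDerivAt_riemannXi_xiSq s).deriv]
  ring

/-- `ξ′(σ) ≠ 0` for real `σ ≠ ½`: `(σ − ½)² ≥ 0` and `ξ₁′ > 0` on `[0, ∞)`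
(`iteratedDeriv_xiSq_ofReal_ne_zero_of_nonneg`, all Taylor coefficients `γ(n) > 0`).
[cite: Conrey1983, §1 (p. 49)] -/
theorem deriv_riemannXi_ofReal_ne_zero {σ : ℝ} (hσ : σ ≠ 1 / 2) : deriv riemannXi σ ≠ 0 := by
  rw [deriv_riemannXi_eq_xiSq]
  refine mul_ne_zero (mul_ne_zero two_ne_zero ?_) ?_
  · intro h
    apply hσ
    have h' : ((σ : ℂ)).re = ((1 / 2 : ℂ)).re := by rw [sub_eq_zero.1 h]
    simpa using h'
  · have hx : (0 : ℝ) ≤ (σ - 1 / 2) ^ 2 := sq_nonneg _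
    have h := iteratedDeriv_xiSq_ofReal_ne_zero_of_nonneg 1 hx
    rw [iteratedDeriv_one] at h
    have e : (((σ - 1 / 2) ^ 2 : ℝ) : ℂ) = ((σ : ℂ) - 1 / 2) ^ 2 := by
      push_cast
      ring
    rwa [e] at h

/-- **The only real zero of `ξ′` is `s = ½`** (`ξ′(½) = 0` by the functional equation
`ξ′(1 − s) = −ξ′(s)` at `s = ½`; the tree also has this value as
`ZetaScrewGrowth.deriv_riemannXi_one_half`, in a file outside this import cone).
[cite: Conrey1983, §1 (p. 49) and Lemma 2 proof (p. 52): ξ^{(m)}(s) = (−1)^m ξ^{(m)}(1−s)] -/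
theorem deriv_riemannXi_ofReal_eq_zero_iff {σ : ℝ} : deriv riemannXi σ = 0 ↔ σ = 1 / 2 := by
  constructor
  · intro h
    by_contra hσ
    exact deriv_riemannXi_ofReal_ne_zero hσ h
  · rintro rfl
    have e : ((1 / 2 : ℝ) : ℂ) = 1 / 2 := by push_cast; ring
    have h := deriv_riemannXi_one_sub (1 / 2 : ℂ)
    rw [show (1 : ℂ) - 1 / 2 = 1 / 2 by norm_num] at h
    have h2 : (2 : ℂ) * deriv riemannXi (1 / 2) = 0 := by linear_combination h
    rw [e]
    exact (mul_eq_zero.1 h2).resolve_left two_ne_zero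

/-- On the critical line `ξ` is real: `Im ξ(½ + it) = 0` (tree `im_riemannXiUpper_ofReal_holds`).
[cite: Conrey1983, §1 (p. 49)] -/
theorem im_riemannXi_critical (t : ℝ) : (riemannXi (1 / 2 + t * I)).im = 0 := by
  have h := im_riemannXiUpper_ofReal_holds t
  rwa [riemannXiUpper, mul_comm] at h

/-- On the critical line `ξ′` is purely imaginary: `Re ξ′(½ + it) = 0` (from `ξ′(s̄) = conj ξ′(s)`
and `ξ′(1 − s) = −ξ′(s)`; tree `conj_deriv_riemannXi_critical`).
[cite: Conrey1983, Lemma 2 proof (p. 52): symmetry of the zeros about the real axis and about σ = ½] -/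
theorem re_deriv_riemannXi_critical (t : ℝ) : (deriv riemannXi (1 / 2 + t * I)).re = 0 := by
  have h1 : deriv riemannXi (conj ((1 / 2 : ℂ) + t * I)) = conj (deriv riemannXi (1 / 2 + t * I)) :=
    deriv_riemannXi_conj _
  have h2 : conj ((1 / 2 : ℂ) + t * I) = 1 - (1 / 2 + t * I) := by
    apply Complex.ext <;> norm_num
  rw [h2, deriv_riemannXi_one_sub] at h1
  have h' := congrArg Complex.re h1
  rw [Complex.neg_re, Complex.conj_re] at h'
  linarith

/-! ## Rolle on the critical line: zeros of `ξ′` between zeros of `ξ` -/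

/-- The derivative of `t ↦ ξ(½ + it)` along the line is `ξ′(½ + it) · i`. [cite: Conrey1983, §1 (p. 49)] -/
theorem hasDerivAt_riemannXi_line (t : ℝ) :
    HasDerivAt (fun u : ℝ ↦ riemannXi (1 / 2 + u * I)) (deriv riemannXi (1 / 2 + t * I) * I) t := by
  have h1 : HasDerivAt (fun w : ℂ ↦ 1 / 2 + w * I) I (t : ℂ) := by
    simpa using ((hasDerivAt_id (t : ℂ)).mul_const I).const_add (1 / 2 : ℂ)
  have h2 : HasDerivAt riemannXi (deriv riemannXi (1 / 2 + t * I)) (1 / 2 + t * I) :=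
    (differentiable_riemannXi _).hasDerivAt
  have h := h2.comp (t : ℂ) h1
  exact h.comp_ofReal

/-- **Rolle on the critical line.** If `ξ(½ + ia) = ξ(½ + ib) = 0` with `a < b`, then
`ξ′(½ + ic) = 0` for some `c ∈ (a, b)`: the real function `t ↦ ξ(½ + it)` has a critical point
`c`, where `Im ξ′(½ + ic) = 0`, and `Re ξ′ = 0` on the whole line. [cite: Conrey1983, §1 (p. 49)] -/
theorem exists_deriv_riemannXi_eq_zero_between {a b : ℝ} (hab : a < b)
    (ha : riemannXi (1 / 2 + a * I) = 0) (hb : riemannXi (1 / 2 + b * I) = 0) :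
    ∃ c ∈ Ioo a b, deriv riemannXi (1 / 2 + c * I) = 0 := by
  set g : ℝ → ℝ := fun u ↦ (riemannXi (1 / 2 + u * I)).re with hg
  have hderiv : ∀ u : ℝ, HasDerivAt g ((deriv riemannXi (1 / 2 + u * I) * I).re) u := fun u ↦ by
    have h := (Complex.reCLM.hasFDerivAt.comp_hasDerivAt u (hasDerivAt_riemannXi_line u))
    exact h
  have hcont : ContinuousOn g (Icc a b) := fun u _ ↦ (hderiv u).continuousAt.continuousWithinAt
  have hgab : g a = g b := by
    simp only [hg]
    rw [ha, hb]
  obtain ⟨c, hc, hc0⟩ := exists_hasDerivAt_eq_zero hab hcont hgab (fun u _ ↦ hderiv u)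
  refine ⟨c, hc, Complex.ext ?_ ?_⟩
  · rw [re_deriv_riemannXi_critical c, Complex.zero_re]
  · have e : (deriv riemannXi (1 / 2 + c * I) * I).re = -(deriv riemannXi (1 / 2 + c * I)).im := by
      simp [Complex.mul_re]
    rw [e] at hc0
    rw [Complex.zero_im]
    linarith

/-- Hardy's theorem in the form needed: zeros `½ + it` of `ζ` with `t` beyond any bound (the zero
set on the line is infinite — tree `hardy_infinite_zeros_on_critical_line_holds` — while its part
with `|t| ≤ R` is finite, `IsCompact.inter_riemannZetaZeros_finite`; `ζ(s̄) = conj ζ(s)` flips signs).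
[cite: Hardy1914, C. R. Acad. Sci. Paris 158 (1914) 1012–1014] -/
theorem exists_riemannZeta_critical_zero_gt (R : ℝ) :
    ∃ t : ℝ, R < t ∧ riemannZeta (1 / 2 + t * I) = 0 := by
  set S : Set ℝ := {t : ℝ | riemannZeta (1 / 2 + t * I) = 0} with hS_def
  have hS : S.Infinite := hardy_infinite_zeros_on_critical_line_holds
  set R' : ℝ := max R 0 with hR'
  have hfin : (S ∩ Icc (-R') R').Finite := by
    have hK : IsCompact (Icc (1 / 2 : ℝ) (1 / 2) ×ℂ Icc (-R') R') :=
      isCompact_Icc.reProdIm isCompact_Icc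
    have hf := hK.inter_riemannZetaZeros_finite
    have hinj : Set.InjOn (fun t : ℝ ↦ (1 / 2 : ℂ) + t * I) (S ∩ Icc (-R') R') := by
      intro t _ u _ h
      have h' := congrArg Complex.im h
      simpa using h'
    refine Set.Finite.of_finite_image (hf.subset ?_) hinj
    rintro z ⟨t, ⟨htS, htR⟩, rfl⟩
    refine ⟨Complex.mem_reProdIm.2 ⟨?_, ?_⟩, htS⟩
    · simp
    · simpa using htR
  obtain ⟨t, htS, htR⟩ := (hS.sdiff hfin).nonempty
  have ht : t ∉ Icc (-R') R' := fun h ↦ htR ⟨htS, h⟩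
  rw [mem_Icc, not_and_or, not_le, not_le] at ht
  rcases ht with ht | ht
  · refine ⟨-t, by rw [hR'] at ht; linarith [le_max_left R 0], ?_⟩
    have hconj : conj ((1 / 2 : ℂ) + t * I) = 1 / 2 + ((-t : ℝ) : ℂ) * I := by
      apply Complex.ext <;> simp
    have hz : riemannZeta (1 / 2 + t * I) = 0 := htS
    rw [← hconj, riemannZeta_conj, hz, map_zero]
  · exact ⟨t, lt_of_le_of_lt (le_max_left R 0) ht, htS⟩

/-- **`ξ′` has zeros on the critical line beyond any height** (Rolle between two zeros of `ξ`
supplied by Hardy's theorem; the zeros of `ξ` on the line are those of `ζ`,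
`riemannXi_eq_zero_iff_holds`). Conrey proves the far stronger `N^{(1)}₀ ≫ T log T`
(Corollary, p. 50); only this qualitative form is proved here. [cite: Conrey1983, Corollary (p. 50)] -/
theorem exists_deriv_riemannXi_eq_zero_gt (M : ℝ) :
    ∃ t : ℝ, M < t ∧ deriv riemannXi (1 / 2 + t * I) = 0 := by
  obtain ⟨a, ha, hza⟩ := exists_riemannZeta_critical_zero_gt M
  obtain ⟨b, hb, hzb⟩ := exists_riemannZeta_critical_zero_gt a
  have hxi : ∀ t : ℝ, riemannZeta (1 / 2 + t * I) = 0 → riemannXi (1 / 2 + t * I) = 0 :=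
    fun t ht ↦ (riemannXi_eq_zero_iff_holds _).2 ⟨ht, by simp, by norm_num⟩
  obtain ⟨c, hc, h0⟩ := exists_deriv_riemannXi_eq_zero_between hb (hxi a hza) (hxi b hzb)
  exact ⟨c, ha.trans hc.1, h0⟩

/-! ## Finiteness of the boxes of zeros of `ξ′`; multiplicities -/

/-- The zero set of `ξ′` is closed and discrete (`ξ′` is entire and `ξ′(2) ≠ 0`).
[cite: Conrey1983, Lemma 2 (p. 52)] -/
theorem isClosed_and_isDiscrete_zeros :
    IsClosed {s : ℂ | deriv riemannXi s = 0} ∧ IsDiscrete {s : ℂ | deriv riemannXi s = 0} :=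
  compl_mem_codiscrete_iff.1 (analyticOnNhd_deriv_riemannXi.preimage_zero_mem_codiscrete
    (x := 2) (deriv_riemannXi_ne_zero_of_one_le_re (by norm_num)))

/-- The multiplicity of `ξ′` at any point is finite (`ξ′` is not identically zero).
[cite: Conrey1983, Lemma 2 (p. 52)] -/
theorem analyticOrderAt_deriv_riemannXi_ne_top (s : ℂ) : analyticOrderAt (deriv riemannXi) s ≠ ⊤ := by
  intro h
  have hzero := (AnalyticOnNhd.analyticOrderAt_eq_top_iff_eq_zero s
    (fun z ↦ analyticOnNhd_deriv_riemannXi z trivial)).1 h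
  exact deriv_riemannXi_ne_zero_of_one_le_re (s := 2) (by norm_num) (by rw [hzero]; rfl)

/-- At a zero of `ξ′` the multiplicity is `≥ 1`. [cite: Conrey1983, Lemma 2 (p. 52)] -/
theorem one_le_analyticOrderAt_toNat {s : ℂ} (hs : deriv riemannXi s = 0) :
    1 ≤ (analyticOrderAt (deriv riemannXi) s).toNat := by
  have hne := analyticOrderAt_deriv_riemannXi_ne_top s
  have hpos : analyticOrderAt (deriv riemannXi) s ≠ 0 := by
    rw [ne_eq, (analyticOnNhd_deriv_riemannXi s trivial).analyticOrderAt_eq_zero]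
    exact not_not.2 hs
  obtain ⟨n, hn⟩ := ENat.ne_top_iff_exists.1 hne
  rw [← hn, ENat.toNat_coe]
  have : n ≠ 0 := by
    rintro rfl
    exact hpos (by rw [← hn]; rfl)
  omega

end XiDerivCount

open XiDerivCount

/-- **The zeros of `ξ′` with `0 < Im s ≤ T` form a finite set** (they lie in the compact rectangle
`[0,1] × [0,T]` by Lemma 2, and the zero set of `ξ′` is discrete), so that `N^{(1)}(T)`,
`N^{(1)}₀(T)` of `XiDerivativeZeros.lean` are genuine finite sums. [cite: Conrey1983, Lemma 2 (p. 52)] -/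
theorem xiDerivZeroBox_one_finite (T : ℝ) : (xiDerivZeroBox 1 T).Finite := by
  obtain ⟨hcl, hdisc⟩ := isClosed_and_isDiscrete_zeros
  have hK : IsCompact (Icc (0 : ℝ) 1 ×ℂ Icc (0 : ℝ) T) := isCompact_Icc.reProdIm isCompact_Icc
  have hfin : (Icc (0 : ℝ) 1 ×ℂ Icc (0 : ℝ) T ∩ {s : ℂ | deriv riemannXi s = 0}).Finite :=
    (hK.inter_right hcl).finite (hdisc.mono Set.inter_subset_right)
  refine hfin.subset ?_
  rintro s ⟨hs, him0, himT⟩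
  have hs' : deriv riemannXi s = 0 := by simpa only [iteratedDeriv_one] using hs
  obtain ⟨h0, h1⟩ := Conrey1983_lemma2_xiDeriv_strip s hs'
  exact ⟨Complex.mem_reProdIm.2 ⟨⟨h0.le, h1.le⟩, ⟨him0.le, himT⟩⟩, hs'⟩

/-- The boxes are nested: `T ≤ T′ ⟹ xiDerivZeroBox m T ⊆ xiDerivZeroBox m T′`. [cite: Conrey1983, Lemma 2 (p. 52)] -/
theorem xiDerivZeroBox_mono (m : ℕ) {T T' : ℝ} (h : T ≤ T') : xiDerivZeroBox m T ⊆ xiDerivZeroBox m T' :=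
  fun _ ⟨h0, h1, h2⟩ ↦ ⟨h0, h1, h2.trans h⟩

/-- `N^{(1)}(T)` is non-decreasing in `T`. [cite: Conrey1983, Lemma 2 (p. 52)] -/
theorem xiDerivZeroCount_one_mono : Monotone (xiDerivZeroCount 1) := by
  intro T T' h
  unfold xiDerivZeroCount
  rw [finsum_mem_eq_finite_toFinset_sum _ (xiDerivZeroBox_one_finite T),
    finsum_mem_eq_finite_toFinset_sum _ (xiDerivZeroBox_one_finite T')]
  exact Finset.sum_le_sum_of_subset
    ((Set.Finite.toFinset_subset_toFinset).2 (xiDerivZeroBox_mono 1 h))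

namespace XiDerivCount

/-- The critical zeros in the box form a finite set. [cite: Conrey1983, §1 (p. 49)] -/
theorem criticalBox_finite (T : ℝ) : {s ∈ xiDerivZeroBox 1 T | s.re = 1 / 2}.Finite :=
  (xiDerivZeroBox_one_finite T).subset (sep_subset _ _)

/-- **Window inequality.** For `T ≤ T′` and any set `S` of zeros of `ξ′` on the line with
`T < Im s ≤ T′` (each listed once): `#S + N^{(1)}₀(T) ≤ N^{(1)}₀(T′)` (the multiplicities are `≥ 1`).
[cite: Conrey1983, §1 (p. 49)] -/
theorem ncard_add_xiDerivCriticalZeroCount_le {T T' : ℝ} (hTT' : T ≤ T') {S : Set ℂ}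
    (hS : S ⊆ {s ∈ xiDerivZeroBox 1 T' | s.re = 1 / 2} \ {s ∈ xiDerivZeroBox 1 T | s.re = 1 / 2}) :
    S.ncard + xiDerivCriticalZeroCount 1 T ≤ xiDerivCriticalZeroCount 1 T' := by
  classical
  have hC' := criticalBox_finite T'
  have hC := criticalBox_finite T
  have hsub : hC.toFinset ⊆ hC'.toFinset := by
    rw [Set.Finite.toFinset_subset_toFinset]
    exact fun s ⟨hs, hre⟩ ↦ ⟨xiDerivZeroBox_mono 1 hTT' hs, hre⟩
  unfold xiDerivCriticalZeroCount
  rw [finsum_mem_eq_finite_toFinset_sum _ hC, finsum_mem_eq_finite_toFinset_sum _ hC',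
    ← Finset.sum_sdiff hsub]
  suffices hsuff : S.ncard ≤
      ∑ s ∈ hC'.toFinset \ hC.toFinset, (analyticOrderAt (iteratedDeriv 1 riemannXi) s).toNat by
    omega
  have hD : S ⊆ ↑(hC'.toFinset \ hC.toFinset) := by
    intro s hs
    rw [Finset.coe_sdiff, Set.Finite.coe_toFinset, Set.Finite.coe_toFinset]
    exact hS hs
  calc S.ncard ≤ (↑(hC'.toFinset \ hC.toFinset) : Set ℂ).ncard :=
        Set.ncard_le_ncard hD (Finset.finite_toSet _)
    _ = (hC'.toFinset \ hC.toFinset).card := Set.ncard_coe_finset _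
    _ = ∑ _s ∈ hC'.toFinset \ hC.toFinset, 1 := by simp
    _ ≤ ∑ s ∈ hC'.toFinset \ hC.toFinset, (analyticOrderAt (iteratedDeriv 1 riemannXi) s).toNat := by
      refine Finset.sum_le_sum fun s hs ↦ ?_
      rw [Finset.mem_sdiff, Set.Finite.mem_toFinset] at hs
      have h0 : iteratedDeriv 1 riemannXi s = 0 := hs.1.1.1
      rw [iteratedDeriv_one] at h0 ⊢
      exact one_le_analyticOrderAt_toNat h0

/-- A set of critical zeros of `ξ′` up to height `T`, each listed once, has at most `N^{(1)}₀(T)`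
elements. [cite: Conrey1983, §1 (p. 49)] -/
theorem ncard_le_xiDerivCriticalZeroCount {T : ℝ} {S : Set ℂ}
    (hS : S ⊆ {s ∈ xiDerivZeroBox 1 T | s.re = 1 / 2}) : S.ncard ≤ xiDerivCriticalZeroCount 1 T := by
  have hneg : xiDerivCriticalZeroCount 1 (-1) = 0 := by
    have hempty : {s ∈ xiDerivZeroBox 1 (-1 : ℝ) | s.re = 1 / 2} = ∅ := by
      ext s
      simp only [mem_sep_iff, mem_empty_iff_false, iff_false, not_and]
      intro hs
      have := hs.2.1
      have := hs.2.2
      linarith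
    unfold xiDerivCriticalZeroCount
    rw [hempty, finsum_mem_empty]
  rcases le_or_gt (-1 : ℝ) T with hT | hT
  · have h := ncard_add_xiDerivCriticalZeroCount_le hT (S := S) (fun s hs ↦ ⟨hS hs, fun h ↦ by
      have := h.1.2.1
      have := h.1.2.2
      linarith⟩)
    omega
  · have hempty : S = ∅ := by
      ext s
      simp only [mem_empty_iff_false, iff_false]
      intro hs
      have h := hS hs
      have := h.1.2.1
      have := h.1.2.2
      linarith
    rw [hempty, Set.ncard_empty]
    exact Nat.zero_le _

end XiDerivCount

/-- `N^{(1)}₀(T) ≤ N^{(1)}(T)`: the critical zeros are among all zeros (a finite sub-sum of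
multiplicities). [cite: Conrey1983, §1 (p. 49)] -/
theorem xiDerivCriticalZeroCount_one_le (T : ℝ) :
    xiDerivCriticalZeroCount 1 T ≤ xiDerivZeroCount 1 T := by
  unfold xiDerivCriticalZeroCount xiDerivZeroCount
  rw [finsum_mem_eq_finite_toFinset_sum _ (criticalBox_finite T),
    finsum_mem_eq_finite_toFinset_sum _ (xiDerivZeroBox_one_finite T)]
  exact Finset.sum_le_sum_of_subset ((Set.Finite.toFinset_subset_toFinset).2 (sep_subset _ _))

/-- `N^{(1)}₀(T)` is non-decreasing in `T`. [cite: Conrey1983, §1 (p. 49)] -/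
theorem xiDerivCriticalZeroCount_one_mono : Monotone (xiDerivCriticalZeroCount 1) := by
  intro T T' h
  have := ncard_add_xiDerivCriticalZeroCount_le h (S := ∅) (empty_subset _)
  rw [Set.ncard_empty, zero_add] at this
  exact this

/-- **`N^{(1)}₀(T) → ∞`**: `ξ′` has infinitely many zeros on the critical line (Hardy + Rolle,
`XiDerivCount.exists_deriv_riemannXi_eq_zero_gt`). Qualitative shadow of Conrey's Lemma 2 / Corollary
(`N^{(1)}₀ ≥ (0.8137 + o(1)) N^{(1)} ~ 0.8137 (T/2π) log T`), which is NOT proved here.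
[cite: Conrey1983, Corollary (p. 50) and Lemma 2 (p. 52)] -/
theorem tendsto_xiDerivCriticalZeroCount_one_atTop :
    Tendsto (xiDerivCriticalZeroCount 1) atTop atTop := by
  refine tendsto_atTop_atTop_of_monotone xiDerivCriticalZeroCount_one_mono fun n ↦ ?_
  induction n with
  | zero => exact ⟨0, Nat.zero_le _⟩
  | succ n ih =>
    obtain ⟨T, hT⟩ := ih
    obtain ⟨t, ht, hz⟩ := exists_deriv_riemannXi_eq_zero_gt (max T 0)
    have hTt : T ≤ t := (le_max_left T 0).trans ht.le
    have ht0 : 0 < t := lt_of_le_of_lt (le_max_right T 0) ht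
    have hre : ((1 / 2 : ℂ) + t * I).re = 1 / 2 := by simp
    have him : ((1 / 2 : ℂ) + t * I).im = t := by simp
    have hmem : (1 / 2 : ℂ) + t * I ∈
        {s ∈ xiDerivZeroBox 1 t | s.re = 1 / 2} \ {s ∈ xiDerivZeroBox 1 T | s.re = 1 / 2} := by
      refine ⟨⟨⟨?_, ?_, ?_⟩, hre⟩, fun h ↦ ?_⟩
      · rw [iteratedDeriv_one]; exact hz
      · rw [him]; exact ht0
      · rw [him]
      · have := h.1.2.2
        rw [him] at this
        linarith [le_max_left T 0]
    have key := ncard_add_xiDerivCriticalZeroCount_le hTt (S := {(1 / 2 : ℂ) + t * I})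
      (singleton_subset_iff.2 hmem)
    rw [Set.ncard_singleton] at key
    exact ⟨t, by omega⟩

/-- **`N^{(1)}(T) → ∞`** (from `N^{(1)}₀ → ∞` and `N^{(1)}₀ ≤ N^{(1)}`). Conrey's Lemma 2 gives the
asymptotic `N^{(1)}(T) = (T/2π) log(T/2π) − T/2π + O(log T)`, NOT proved here.
[cite: Conrey1983, Lemma 2 (p. 52)] -/
theorem tendsto_xiDerivZeroCount_one_atTop : Tendsto (xiDerivZeroCount 1) atTop atTop :=
  tendsto_atTop_mono xiDerivCriticalZeroCount_one_le tendsto_xiDerivCriticalZeroCount_one_atTop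

/-! ## `liminf` bookkeeping for `κ′₁ = xiDerivCriticalLineProportion 1` -/

/-- **From a per-`T` proportion to `κ′₁`.** If `c · N^{(1)}(T) ≤ N^{(1)}₀(T)` for all large `T`,
then `c ≤ κ′₁ = liminf N^{(1)}₀/N^{(1)}` (the ratio is `≤ 1`, hence cobounded, and `N^{(1)}(T) > 0`
for large `T`). The `ξ′`-copy of `le_criticalLineProportion_of_eventually_le`.
[cite: Conrey1983, §1 (p. 49): definition of the proportion] -/
theorem le_xiDerivCriticalLineProportion_one_of_eventually_le {c : ℝ}
    (h : ∀ᶠ T : ℝ in atTop, c * (xiDerivZeroCount 1 T : ℝ) ≤ xiDerivCriticalZeroCount 1 T) :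
    c ≤ xiDerivCriticalLineProportion 1 := by
  have hle : ∀ T : ℝ, (xiDerivCriticalZeroCount 1 T : ℝ) / xiDerivZeroCount 1 T ≤ 1 := fun T ↦ by
    rcases Nat.eq_zero_or_pos (xiDerivZeroCount 1 T) with h0 | hpos
    · simp [h0]
    · rw [div_le_one (by exact_mod_cast hpos)]
      exact_mod_cast xiDerivCriticalZeroCount_one_le T
  unfold xiDerivCriticalLineProportion
  refine le_liminf_of_le (isCoboundedUnder_ge_of_le atTop (x := 1) hle) ?_
  filter_upwards [h, tendsto_xiDerivZeroCount_one_atTop.eventually_gt_atTop 0] with T hT hN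
  rw [le_div_iff₀ (by exact_mod_cast hN)]
  exact hT

namespace XiDerivCount

/-- Telescoping over dyadic windows, for a non-decreasing count `N` and a non-negative `A`: if
`c (N(2T) − N(T)) ≤ A(2T) − A(T)` for all `T ≥ T₀ ≥ 0` (`c ≥ 0`), then `c (N(T) − N(2T₀)) ≤ A(T)`
for `T₀ ≤ T ≤ 2^{n+1} T₀`. (Generic copy of `AlpogeFurman2026.Dyadic.telescope`.)
[cite: AlpogeFurman2026, §6 proof of Theorem A (p. 12): "summing over dyadic windows"] -/
theorem telescope {N A : ℝ → ℝ} (hN : Monotone N) (hA : ∀ T, 0 ≤ A T) {c : ℝ} (hc : 0 ≤ c)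
    {T₀ : ℝ} (hT₀ : 0 ≤ T₀)
    (h : ∀ T, T₀ ≤ T → c * (N (2 * T) - N T) ≤ A (2 * T) - A T) :
    ∀ n : ℕ, ∀ T, T₀ ≤ T → T ≤ 2 ^ (n + 1) * T₀ → c * (N T - N (2 * T₀)) ≤ A T := by
  intro n
  induction n with
  | zero =>
    intro T _ h2
    have hNT : N T ≤ N (2 * T₀) := hN (by simpa using h2)
    nlinarith [hA T]
  | succ n ih =>
    intro T h1 h2
    by_cases hle : T ≤ 2 ^ (n + 1) * T₀
    · exact ih T h1 hle
    · have hlt : 2 ^ (n + 1) * T₀ < T := lt_of_not_ge hle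
      have h2pow : (2 : ℝ) ≤ 2 ^ (n + 1) := by
        calc (2 : ℝ) = 2 ^ 1 := by norm_num
          _ ≤ 2 ^ (n + 1) := pow_le_pow_right₀ (by norm_num) (by omega)
      have h3 : T₀ ≤ T / 2 := by nlinarith
      have h4 : T / 2 ≤ 2 ^ (n + 1) * T₀ := by
        rw [pow_succ] at h2
        linarith
      have hih := ih (T / 2) h3 h4
      have hstep := h (T / 2) h3
      rw [show 2 * (T / 2) = T by ring] at hstep
      linarith

/-- From the telescoped bound to the cumulative proportion, for a count `N → ∞`: if
`c (N(T) − N(2T₀)) ≤ A(T)` for all `T ≥ T₀`, then for every `δ > 0`, eventually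
`(c − δ) N(T) ≤ A(T)`. (Generic copy of `AlpogeFurman2026.Dyadic.eventually_of_telescope`.)
[cite: AlpogeFurman2026, §6 proof of Theorem A (p. 12)] -/
theorem eventually_of_telescope {N A : ℝ → ℝ} (hlim : Tendsto N atTop atTop) {c T₀ : ℝ}
    (h : ∀ T, T₀ ≤ T → c * (N T - N (2 * T₀)) ≤ A T) {δ : ℝ} (hδ : 0 < δ) :
    ∀ᶠ T : ℝ in atTop, (c - δ) * N T ≤ A T := by
  filter_upwards [eventually_ge_atTop T₀, hlim.eventually_ge_atTop (c * N (2 * T₀) / δ)]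
    with T hT hMT
  have h1 := h T hT
  have h2 : c * N (2 * T₀) ≤ δ * N T := by
    rw [div_le_iff₀ hδ] at hMT
    linarith
  nlinarith

/-- All the dyadic windows `(T, 2^{n+1}T]`, eventually: every `T ≥ T₀ > 0` satisfies
`T ≤ 2^{n+1} T₀` for some `n`. [cite: AlpogeFurman2026, §6 proof of Theorem A (p. 12)] -/
theorem exists_le_two_pow_mul {T₀ T : ℝ} (hT₀ : 0 < T₀) : ∃ n : ℕ, T ≤ 2 ^ (n + 1) * T₀ := by
  obtain ⟨n, hn⟩ := pow_unbounded_of_one_lt (T / T₀) (by norm_num : (1 : ℝ) < 2)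
  refine ⟨n, ?_⟩
  have : T / T₀ ≤ 2 ^ (n + 1) := hn.le.trans (pow_le_pow_right₀ (by norm_num) (by omega))
  rwa [div_le_iff₀ hT₀] at this

/-- The simple critical zeros of `ξ′` in the window `(T, 2T]` are at most `N^{(1)}₀(2T) − N^{(1)}₀(T)`
in number (`0 ≤ T`). [cite: AlpogeFurman2026, Remark 7.1 (p. 14)] -/
theorem ncard_window_le {T : ℝ} (hT : 0 ≤ T) :
    (Set.ncard {s ∈ xiDerivZeroBox 1 (2 * T) \ xiDerivZeroBox 1 T |
        s.re = 1 / 2 ∧ analyticOrderAt (iteratedDeriv 1 riemannXi) s = 1} : ℝ) ≤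
      (xiDerivCriticalZeroCount 1 (2 * T) : ℝ) - xiDerivCriticalZeroCount 1 T := by
  have h2T : T ≤ 2 * T := by linarith
  have h := ncard_add_xiDerivCriticalZeroCount_le h2T
    (S := {s ∈ xiDerivZeroBox 1 (2 * T) \ xiDerivZeroBox 1 T |
      s.re = 1 / 2 ∧ analyticOrderAt (iteratedDeriv 1 riemannXi) s = 1})
    (fun s ⟨⟨h2, h1⟩, hre, _⟩ ↦ ⟨⟨h2, hre⟩, fun h ↦ h1 h.1⟩)
  have h' : ((Set.ncard {s ∈ xiDerivZeroBox 1 (2 * T) \ xiDerivZeroBox 1 T |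
        s.re = 1 / 2 ∧ analyticOrderAt (iteratedDeriv 1 riemannXi) s = 1} : ℕ) : ℝ) +
      (xiDerivCriticalZeroCount 1 T : ℝ) ≤ xiDerivCriticalZeroCount 1 (2 * T) := by
    exact_mod_cast h
  linarith

/-- The simple critical zeros of `ξ′` up to height `T`, as a finite set, and the window as a set
difference: for `0 ≤ T`, `#(window (T,2T]) = #(up to 2T) − #(up to T)`.
[cite: AlpogeFurman2026, Remark 7.1 (p. 14)] -/
theorem ncard_window_eq {T : ℝ} (hT : 0 ≤ T) :
    (Set.ncard {s ∈ xiDerivZeroBox 1 (2 * T) \ xiDerivZeroBox 1 T |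
        s.re = 1 / 2 ∧ analyticOrderAt (iteratedDeriv 1 riemannXi) s = 1} : ℝ) =
      (Set.ncard {s ∈ xiDerivZeroBox 1 (2 * T) |
          s.re = 1 / 2 ∧ analyticOrderAt (iteratedDeriv 1 riemannXi) s = 1} : ℝ) -
        Set.ncard {s ∈ xiDerivZeroBox 1 T |
          s.re = 1 / 2 ∧ analyticOrderAt (iteratedDeriv 1 riemannXi) s = 1} := by
  have h2T : T ≤ 2 * T := by linarith
  have hsub : {s ∈ xiDerivZeroBox 1 T | s.re = 1 / 2 ∧ analyticOrderAt (iteratedDeriv 1 riemannXi) s = 1} ⊆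
      {s ∈ xiDerivZeroBox 1 (2 * T) | s.re = 1 / 2 ∧ analyticOrderAt (iteratedDeriv 1 riemannXi) s = 1} :=
    fun s ⟨hs, hp⟩ ↦ ⟨xiDerivZeroBox_mono 1 h2T hs, hp⟩
  have hfin : {s ∈ xiDerivZeroBox 1 (2 * T) |
      s.re = 1 / 2 ∧ analyticOrderAt (iteratedDeriv 1 riemannXi) s = 1}.Finite :=
    (xiDerivZeroBox_one_finite _).subset (sep_subset _ _)
  have heq : {s ∈ xiDerivZeroBox 1 (2 * T) \ xiDerivZeroBox 1 T |
        s.re = 1 / 2 ∧ analyticOrderAt (iteratedDeriv 1 riemannXi) s = 1} =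
      {s ∈ xiDerivZeroBox 1 (2 * T) | s.re = 1 / 2 ∧ analyticOrderAt (iteratedDeriv 1 riemannXi) s = 1} \
        {s ∈ xiDerivZeroBox 1 T | s.re = 1 / 2 ∧ analyticOrderAt (iteratedDeriv 1 riemannXi) s = 1} := by
    ext s
    constructor
    · rintro ⟨⟨h2, h1⟩, hp⟩
      exact ⟨⟨h2, hp⟩, fun h ↦ h1 h.1⟩
    · rintro ⟨⟨h2, hp⟩, hn⟩
      exact ⟨⟨h2, fun h ↦ hn ⟨h, hp⟩⟩, hp⟩
  rw [heq, Set.ncard_sdiff hsub (hfin.subset hsub), Nat.cast_sub (Set.ncard_le_ncard hsub hfin)]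

end XiDerivCount

/-- **Dyadic simple-critical proportion ⟹ `liminf` proportion, for `ξ′`.** If for every `ε > 0`,
eventually `(c − ε)(N^{(1)}(2T) − N^{(1)}(T)) ≤ #{simple zeros of ξ′ on the line with T < Im s ≤ 2T}`
(the shape of `AlpogeFurman2026_xiDeriv_simple_critical_dyadic`, constant `c`), then `c ≤ κ′₁`:
telescoping over dyadic windows and `N^{(1)}(T) → ∞`.
[cite: AlpogeFurman2026, Remark 7.1 (p. 14) and §6 (p. 12)] -/
theorem le_xiDerivCriticalLineProportion_one_of_dyadic {c : ℝ}
    (h : ∀ ε : ℝ, 0 < ε → ∀ᶠ T : ℝ in atTop,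
      (c - ε) * ((xiDerivZeroCount 1 (2 * T) : ℝ) - xiDerivZeroCount 1 T) ≤
        (Set.ncard {s ∈ xiDerivZeroBox 1 (2 * T) \ xiDerivZeroBox 1 T |
          s.re = 1 / 2 ∧ analyticOrderAt (iteratedDeriv 1 riemannXi) s = 1} : ℝ)) :
    c ≤ xiDerivCriticalLineProportion 1 := by
  refine le_of_forall_sub_le fun ε hε ↦ le_xiDerivCriticalLineProportion_one_of_eventually_le ?_
  by_cases hc : c - ε / 2 < 0
  · refine Filter.Eventually.of_forall fun T ↦ ?_
    have h0 : (0 : ℝ) ≤ xiDerivCriticalZeroCount 1 T := Nat.cast_nonneg _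
    have hN0 : (0 : ℝ) ≤ xiDerivZeroCount 1 T := Nat.cast_nonneg _
    nlinarith
  · have hc' : 0 ≤ c - ε / 2 := le_of_not_gt hc
    obtain ⟨T₁, hT₁⟩ := Filter.eventually_atTop.1 (h (ε / 2) (half_pos hε))
    set T₀ : ℝ := max T₁ 1 with hT₀_def
    have hT₀ : 0 ≤ T₀ := le_trans zero_le_one (le_max_right _ _)
    have hT₀pos : 0 < T₀ := lt_of_lt_of_le zero_lt_one (le_max_right _ _)
    have hstep : ∀ T, T₀ ≤ T → (c - ε / 2) *
        ((fun T ↦ (xiDerivZeroCount 1 T : ℝ)) (2 * T) - (fun T ↦ (xiDerivZeroCount 1 T : ℝ)) T) ≤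
        (fun T ↦ (xiDerivCriticalZeroCount 1 T : ℝ)) (2 * T) -
          (fun T ↦ (xiDerivCriticalZeroCount 1 T : ℝ)) T := fun T hT ↦ by
      have h1 := hT₁ T (le_trans (le_max_left _ _) hT)
      have h2 := XiDerivCount.ncard_window_le (hT₀.trans hT)
      exact h1.trans h2
    have hmono : Monotone fun T ↦ (xiDerivZeroCount 1 T : ℝ) :=
      fun a b hab ↦ Nat.cast_le.2 (xiDerivZeroCount_one_mono hab)
    have htel := XiDerivCount.telescope hmono (fun T ↦ Nat.cast_nonneg _) hc' hT₀ hstep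
    have hall : ∀ T, T₀ ≤ T → (c - ε / 2) *
        ((xiDerivZeroCount 1 T : ℝ) - xiDerivZeroCount 1 (2 * T₀)) ≤ xiDerivCriticalZeroCount 1 T :=
      fun T hT ↦ by
        obtain ⟨n, hn⟩ := XiDerivCount.exists_le_two_pow_mul (T := T) hT₀pos
        exact htel n T hT hn
    have hlim : Tendsto (fun T ↦ (xiDerivZeroCount 1 T : ℝ)) atTop atTop :=
      tendsto_natCast_atTop_atTop.comp tendsto_xiDerivZeroCount_one_atTop
    have := XiDerivCount.eventually_of_telescope hlim hall (half_pos hε)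
    refine this.mono fun T hT ↦ ?_
    have e : c - ε / 2 - ε / 2 = c - ε := by ring
    rwa [e] at hT

/-- **Dyadic simple-critical proportion ⟹ cumulative simple-critical proportion, for `ξ′`**
("the same holds for `(0,T)` in place of `(T,2T)`", [AF26] p. 2, in the `ξ′` setting of Remark 7.1):
if for every `ε > 0`, eventually `(c − ε)(N^{(1)}(2T) − N^{(1)}(T)) ≤ #{simple critical zeros of ξ′
in (T,2T]}`, then for every `ε > 0` and all large `T`,
`(c − ε) N^{(1)}(T) ≤ #{s : ξ′(s) = 0, 0 < Im s ≤ T, Re s = ½, simple}`.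
[cite: AlpogeFurman2026, Remark 7.1 (p. 14) and p. 2, §6 (p. 12)] -/
theorem XiDerivCount.eventually_cumulative_of_dyadic {c : ℝ}
    (h : ∀ ε : ℝ, 0 < ε → ∀ᶠ T : ℝ in atTop,
      (c - ε) * ((xiDerivZeroCount 1 (2 * T) : ℝ) - xiDerivZeroCount 1 T) ≤
        (Set.ncard {s ∈ xiDerivZeroBox 1 (2 * T) \ xiDerivZeroBox 1 T |
          s.re = 1 / 2 ∧ analyticOrderAt (iteratedDeriv 1 riemannXi) s = 1} : ℝ)) :
    ∀ ε : ℝ, 0 < ε → ∀ᶠ T : ℝ in atTop,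
      (c - ε) * (xiDerivZeroCount 1 T : ℝ) ≤
        (Set.ncard {s ∈ xiDerivZeroBox 1 T |
          s.re = 1 / 2 ∧ analyticOrderAt (iteratedDeriv 1 riemannXi) s = 1} : ℝ) := by
  intro ε hε
  by_cases hc : c - ε / 2 < 0
  · refine Filter.Eventually.of_forall fun T ↦ ?_
    have h0 : (0 : ℝ) ≤ (Set.ncard {s ∈ xiDerivZeroBox 1 T |
        s.re = 1 / 2 ∧ analyticOrderAt (iteratedDeriv 1 riemannXi) s = 1} : ℝ) := Nat.cast_nonneg _
    have hN0 : (0 : ℝ) ≤ xiDerivZeroCount 1 T := Nat.cast_nonneg _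
    nlinarith
  · have hc' : 0 ≤ c - ε / 2 := le_of_not_gt hc
    obtain ⟨T₁, hT₁⟩ := Filter.eventually_atTop.1 (h (ε / 2) (half_pos hε))
    set T₀ : ℝ := max T₁ 1 with hT₀_def
    have hT₀ : 0 ≤ T₀ := le_trans zero_le_one (le_max_right _ _)
    have hT₀pos : 0 < T₀ := lt_of_lt_of_le zero_lt_one (le_max_right _ _)
    set A : ℝ → ℝ := fun T ↦ (Set.ncard {s ∈ xiDerivZeroBox 1 T |
      s.re = 1 / 2 ∧ analyticOrderAt (iteratedDeriv 1 riemannXi) s = 1} : ℝ) with hA_def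
    have hstep : ∀ T, T₀ ≤ T → (c - ε / 2) *
        ((fun T ↦ (xiDerivZeroCount 1 T : ℝ)) (2 * T) - (fun T ↦ (xiDerivZeroCount 1 T : ℝ)) T) ≤
        A (2 * T) - A T := fun T hT ↦ by
      have h1 := hT₁ T (le_trans (le_max_left _ _) hT)
      rw [XiDerivCount.ncard_window_eq (hT₀.trans hT)] at h1
      exact h1
    have hmono : Monotone fun T ↦ (xiDerivZeroCount 1 T : ℝ) :=
      fun a b hab ↦ Nat.cast_le.2 (xiDerivZeroCount_one_mono hab)
    have hA : ∀ T, 0 ≤ A T := fun T ↦ Nat.cast_nonneg _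
    have htel := XiDerivCount.telescope hmono hA hc' hT₀ hstep
    have hall : ∀ T, T₀ ≤ T → (c - ε / 2) *
        ((xiDerivZeroCount 1 T : ℝ) - xiDerivZeroCount 1 (2 * T₀)) ≤ A T :=
      fun T hT ↦ by
        obtain ⟨n, hn⟩ := XiDerivCount.exists_le_two_pow_mul (T := T) hT₀pos
        exact htel n T hT hn
    have hlim : Tendsto (fun T ↦ (xiDerivZeroCount 1 T : ℝ)) atTop atTop :=
      tendsto_natCast_atTop_atTop.comp tendsto_xiDerivZeroCount_one_atTop
    have := XiDerivCount.eventually_of_telescope hlim hall (half_pos hε)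
    refine this.mono fun T hT ↦ ?_
    have e : c - ε / 2 - ε / 2 = c - ε := by ring
    rwa [e] at hT


/-! ## Under RH: `N^{(1)}₀ = N^{(1)}`, `κ′₁ = 1` (RH-CONDITIONAL implications; RH is the explicit hypothesis) -/

/-- RH-CONDITIONAL. Under RH every zero of `ξ′` is on the critical line (Conrey 1983, p. 49; tree
`riemannHypothesis_imp_xiDeriv_zeros_on_line_holds`), so the critical box is the whole box and
`N^{(1)}₀(T) = N^{(1)}(T)`. [cite: Conrey1983, §1 (p. 49): "the Riemann hypothesis implies that all of the zeros of ξ^{(m)}(s) have real part ½"] -/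
theorem xiDerivCriticalZeroCount_one_eq_of_RH (hRH : RiemannHypothesis) (T : ℝ) :
    xiDerivCriticalZeroCount 1 T = xiDerivZeroCount 1 T := by
  have hset : {s ∈ xiDerivZeroBox 1 T | s.re = 1 / 2} = xiDerivZeroBox 1 T := by
    ext s
    constructor
    · exact fun h ↦ h.1
    · intro h
      have h0 : deriv riemannXi s = 0 := by simpa only [iteratedDeriv_one] using h.1
      exact ⟨h, riemannHypothesis_imp_xiDeriv_zeros_on_line_holds hRH s h0⟩
  unfold xiDerivCriticalZeroCount xiDerivZeroCount
  rw [hset]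

/-- RH-CONDITIONAL. Under RH, `κ′₁ = liminf N^{(1)}₀/N^{(1)} = 1` (the ratio is eventually the
constant `1`, `N^{(1)}(T) > 0` for large `T`). [cite: Conrey1983, §1 (p. 49)] -/
theorem xiDerivCriticalLineProportion_one_eq_one_of_RH (hRH : RiemannHypothesis) :
    xiDerivCriticalLineProportion 1 = 1 := by
  unfold xiDerivCriticalLineProportion
  have hev : ∀ᶠ T : ℝ in atTop,
      (xiDerivCriticalZeroCount 1 T : ℝ) / xiDerivZeroCount 1 T = (fun _ : ℝ ↦ (1 : ℝ)) T := by
    filter_upwards [tendsto_xiDerivZeroCount_one_atTop.eventually_gt_atTop 0] with T hT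
    rw [xiDerivCriticalZeroCount_one_eq_of_RH hRH]
    exact div_self (by exact_mod_cast hT.ne')
  rw [liminf_congr hev, liminf_const]

/-- RH-CONDITIONAL sanity check of the statement layer: RH ⟹ `conrey1983_xiDeriv_one`
(`0.8137 ≤ 1 = κ′₁`). [cite: Conrey1983, §1 (p. 49) and Corollary (p. 50)] -/
theorem conrey1983_xiDeriv_one_of_RH (hRH : RiemannHypothesis) : conrey1983_xiDeriv_one := by
  unfold conrey1983_xiDeriv_one
  rw [xiDerivCriticalLineProportion_one_eq_one_of_RH hRH]
  norm_num

end Literature.NumberTheory.LFunctions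

end
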